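import Literature.Analysis.FluidPDE.ESSLocalHolderBlowupLocalEnergy
import Literature.Analysis.FluidPDE.BlowupLimitBounds
import Literature.Analysis.FluidPDE.LocalTypeILscVelocity
import Literature.Analysis.FluidPDE.Seregin2020CubicLowerBound
import HarnessLib

/-!
# Seregin 2019, §4: scale-invariant bounds of a strong `L³_loc` limit and its uniformly local
# dissipation

Analysis/FluidPDE proofs-only file (theorems only: no definitions, no named facts, no `sorry`),
a tranche of the input `Literature.Analysis.FluidPDE.seregin2019_localWeakL3_epsRegularity`
(`Seregin2019LocalWeakL3.lean`; G. Seregin, arXiv:1906.06707 = St. Petersburg Math. J. 32 (2021)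
565–576, §4). No Navier–Stokes regularity statement is proved here.

In §4 (p. 8) the limit `(u, p)` of the rescaled pairs keeps the scale-invariant bounds of the
sequence, "`Θ(u,p,R;e₀) ≤ c(M)(N+1)` for any `R > 0` and `e₀ ∈ Q₋`", and its non-triviality
"`ϱ⁻² ∫_{Q(ϱ)} |u|³ ≥ ε⋆/2`". For a general sequence `(v_k, q_k) → (w, π)` on the expanding balls
`Q(a)` (velocities strongly in `L³(Q(a))`, pressures weakly in `L^{3/2}(Q(a))`, the output of
`LocalTypeIBlowup.local_suitableCompactness`) this file records: lower bounds of `C` at one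
scale pass to the limit (`Seregin2020.le_cknC_of_tendsto_eLpNorm`); upper bounds of `C` and `D`
at every apex of the closed half-space pass to the limit (`cknC_le_of_tendsto_eLpNorm`, weak lower
semicontinuity `setLIntegral_rpow_threeHalves_le_of_tendsto_weakly`); and from the latter the
**uniformly local dissipation** of the limit on the boxes `]-T,0[ × B(x₀,R)` — the hypothesis
`hG` of `Seregin2019.exists_restart_weakL3` — by Lemarié-Rieusset's absolute local energy bound
(`localEnergyBound`, proof of Thm. 14.4) exactly as in the tree's
`ESSBlowup.exists_weakGradient_uniform_dissipation`, the global bound (6.6.9) of the `L³` case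
being replaced by the apex-wise bounds `C(ϱ; z) ≤ K`, `D(ϱ; z) ≤ K`.

## References

* G. Seregin, arXiv:1906.06707 (2019), §4 p. 8 (`Θ(u,p,R;e₀) ≤ c(M)(N+1)`; `∫_{Q(ϱ)}|u|³ ≥ ε⋆ϱ²/2`).
  [`Seregin2019`]
* P. G. Lemarié-Rieusset, *The Navier–Stokes Problem in the 21st Century* (2016), proof of
  Thm. 14.4 (the absolute local energy bound). [`LemarieRieusset2016`]
-/

noncomputable section

open MeasureTheory Set Function Filter Topology TopologicalSpace Metric
open scoped NNReal ENNReal InnerProductSpace RealInnerProductSpace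

namespace Literature.Analysis.FluidPDE

namespace Seregin2019

variable {v : ℕ → ℝ → EuclideanSpace ℝ (Fin 3) → EuclideanSpace ℝ (Fin 3)}
  {q : ℕ → ℝ → EuclideanSpace ℝ (Fin 3) → ℝ}
  {w : ℝ → EuclideanSpace ℝ (Fin 3) → EuclideanSpace ℝ (Fin 3)}
  {π : ℝ → EuclideanSpace ℝ (Fin 3) → ℝ}

/-! ### Apices of the closed half-space and the expanding balls -/

/-- A cylinder `Q_ϱ(z)` hanging from an apex `z` with `z.1 ≤ 0` lies in some `Q(a)`, `a > 0`. [folklore] -/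
private theorem exists_parabolicCylinder_subset_origin {z : ℝ × EuclideanSpace ℝ (Fin 3)} (hz : z.1 ≤ 0)
    {ϱ : ℝ} (hϱ : 0 < ϱ) :
    ∃ a : ℝ, 0 < a ∧ parabolicCylinder ϱ z ⊆ parabolicCylinder a (0 : ℝ × EuclideanSpace ℝ (Fin 3)) := by
  set a : ℝ := ‖z.2‖ + ϱ + Real.sqrt (-z.1) + 1 with ha
  have hapos : 0 < a := by rw [ha]; positivity
  refine ⟨a, hapos, fun y hy => ?_⟩
  rw [mem_parabolicCylinder] at hy
  rw [SuitableCompactness.parabolicCylinder_zero, mem_prod, mem_Ioo, mem_ball, dist_zero_right]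
  obtain ⟨⟨h1, h2⟩, h3⟩ := hy
  have hsq : Real.sqrt (-z.1) ^ 2 = -z.1 := Real.sq_sqrt (by linarith)
  have hy2 : ‖y.2‖ < ‖z.2‖ + ϱ := by
    calc ‖y.2‖ = dist y.2 0 := (dist_zero_right _).symm
      _ ≤ dist y.2 z.2 + dist z.2 0 := dist_triangle _ _ _
      _ < ϱ + ‖z.2‖ := by rw [dist_zero_right]; linarith [mem_ball.1 h3]
      _ = ‖z.2‖ + ϱ := add_comm _ _
  refine ⟨⟨?_, lt_of_lt_of_le h2 hz⟩, by rw [ha]; linarith [Real.sqrt_nonneg (-z.1)]⟩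
  -- `-a² < z.1 - ϱ² < y.1`
  have h4 : ϱ + Real.sqrt (-z.1) < a := by rw [ha]; linarith [norm_nonneg z.2]
  have h5 : (ϱ + Real.sqrt (-z.1)) ^ 2 < a ^ 2 := by
    exact pow_lt_pow_left₀ h4 (by positivity) two_ne_zero
  nlinarith [Real.sqrt_nonneg (-z.1)]

/-! ### Lower bound of `C` at one scale -/

/-- **Non-triviality passes to the limit** (Seregin 2019, §4 p. 8: `ϱ⁻² ∫_{Q(ϱ)} |u|³ ≥ ε⋆/2` for
the limit): if `v_k → w` in `L³(Q(a))` with `Q_ϱ(z) ⊆ Q(a)` and `κ ≤ C(ϱ; z)[v_k]` eventually, then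
`κ ≤ C(ϱ; z)[w]` (`Seregin2020.le_cknC_of_tendsto_eLpNorm` along the tail of the sequence).
[cite: Seregin2019, §4 p. 8 (non-triviality of the limit)] -/
theorem le_cknC_of_tendsto_eventually {a ϱ : ℝ} (hϱ : 0 < ϱ) {z : ℝ × EuclideanSpace ℝ (Fin 3)}
    (hQ : parabolicCylinder ϱ z ⊆ parabolicCylinder a (0 : ℝ × EuclideanSpace ℝ (Fin 3)))
    (hvm : ∀ᶠ k in atTop, AEStronglyMeasurable (uncurry (v k))
      (volume.restrict (parabolicCylinder a (0 : ℝ × EuclideanSpace ℝ (Fin 3)))))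
    (hwm : AEStronglyMeasurable (uncurry w)
      (volume.restrict (parabolicCylinder a (0 : ℝ × EuclideanSpace ℝ (Fin 3)))))
    (hconv : Tendsto (fun k => eLpNorm (uncurry (v k) - uncurry w) 3
      (volume.restrict (parabolicCylinder a (0 : ℝ × EuclideanSpace ℝ (Fin 3))))) atTop (𝓝 0))
    {κ : ℝ≥0∞} (hbound : ∀ᶠ k in atTop, κ ≤ cknC ϱ z (v k)) : κ ≤ cknC ϱ z w := by
  obtain ⟨k₀, hk₀⟩ := eventually_atTop.1 (hvm.and hbound)
  exact Seregin2020.le_cknC_of_tendsto_eLpNorm (v := fun k => v (k + k₀)) hϱ hQ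
    (fun k => (hk₀ (k + k₀) (Nat.le_add_left _ _)).1) hwm (hconv.comp (tendsto_add_atTop_nat k₀))
    (fun k => (hk₀ (k + k₀) (Nat.le_add_left _ _)).2)

/-! ### Upper bounds of `C` and `D` at every apex -/

/-- **The cubic bound passes to the limit at every apex** (`Θ(u,p,R;e₀) ≤ c(M)(N+1)`, the `C`
part): if `v_k → w` in `L³(Q(a))` for every `a > 0` and `C(ϱ; z)[v_k] ≤ K` eventually, for an apex
`z` with `z.1 ≤ 0`, then `C(ϱ; z)[w] ≤ K`. [cite: Seregin2019, §4 p. 8 (Θ(u,p,R;e₀) ≤ c(M)(N+1))] -/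
theorem cknC_le_of_tendsto_eventually
    (hvm : ∀ a : ℝ, 0 < a → ∀ᶠ k in atTop, AEStronglyMeasurable (uncurry (v k))
      (volume.restrict (parabolicCylinder a (0 : ℝ × EuclideanSpace ℝ (Fin 3)))))
    (hwm : ∀ a : ℝ, 0 < a → AEStronglyMeasurable (uncurry w)
      (volume.restrict (parabolicCylinder a (0 : ℝ × EuclideanSpace ℝ (Fin 3)))))
    (hconv : ∀ a : ℝ, 0 < a → Tendsto (fun k => eLpNorm (uncurry (v k) - uncurry w) 3
      (volume.restrict (parabolicCylinder a (0 : ℝ × EuclideanSpace ℝ (Fin 3))))) atTop (𝓝 0))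
    {z : ℝ × EuclideanSpace ℝ (Fin 3)} (hz : z.1 ≤ 0) {ϱ : ℝ} (hϱ : 0 < ϱ) {K : ℝ≥0∞}
    (hbound : ∀ᶠ k in atTop, cknC ϱ z (v k) ≤ K) : cknC ϱ z w ≤ K := by
  obtain ⟨a, ha, hQ⟩ := exists_parabolicCylinder_subset_origin hz hϱ
  obtain ⟨k₀, hk₀⟩ := eventually_atTop.1 ((hvm a ha).and hbound)
  exact cknC_le_of_tendsto_eLpNorm (v := fun k => v (k + k₀)) hϱ hQ
    (fun k => (hk₀ (k + k₀) (Nat.le_add_left _ _)).1) (hwm a ha)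
    ((hconv a ha).comp (tendsto_add_atTop_nat k₀)) (fun k => (hk₀ (k + k₀) (Nat.le_add_left _ _)).2)

/-- **The pressure bound passes to the weak limit at every apex** (the `D` part of
`Θ(u,p,R;e₀) ≤ c(M)(N+1)` for the limit; weak lower semicontinuity of the `L^{3/2}` norm): if
`q_k ⇀ π` weakly in `L^{3/2}(Q(a))` (tested against `L³(Q(a))`) with `π ∈ L^{3/2}(Q(a))` for every
`a > 0`, and `D(ϱ; z)[q_k] ≤ K` eventually, `z.1 ≤ 0`, then `D(ϱ; z)[π] ≤ K`.
[cite: Seregin2019, §4 p. 8 (Θ(u,p,R;e₀) ≤ c(M)(N+1))] -/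
theorem cknD_le_of_tendsto_weakly_eventually
    (hqm : ∀ a : ℝ, 0 < a → ∀ᶠ k in atTop, AEStronglyMeasurable (uncurry (q k))
      (volume.restrict (parabolicCylinder a (0 : ℝ × EuclideanSpace ℝ (Fin 3)))))
    (hπ : ∀ a : ℝ, 0 < a → MemLp (uncurry π) (3 / 2)
      (volume.restrict (parabolicCylinder a (0 : ℝ × EuclideanSpace ℝ (Fin 3)))))
    (hweak : ∀ a : ℝ, 0 < a → ∀ g : ℝ × EuclideanSpace ℝ (Fin 3) → ℝ,
      MemLp g 3 (volume.restrict (parabolicCylinder a (0 : ℝ × EuclideanSpace ℝ (Fin 3)))) →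
      Tendsto (fun k => ∫ y in parabolicCylinder a (0 : ℝ × EuclideanSpace ℝ (Fin 3)), q k y.1 y.2 * g y)
        atTop (𝓝 (∫ y in parabolicCylinder a (0 : ℝ × EuclideanSpace ℝ (Fin 3)), π y.1 y.2 * g y)))
    {z : ℝ × EuclideanSpace ℝ (Fin 3)} (hz : z.1 ≤ 0) {ϱ : ℝ} (hϱ : 0 < ϱ) {K : ℝ≥0∞}
    (hbound : ∀ᶠ k in atTop, cknD ϱ z (q k) ≤ K) : cknD ϱ z π ≤ K := by
  obtain ⟨a, ha, hQ⟩ := exists_parabolicCylinder_subset_origin hz hϱ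
  obtain ⟨k₀, hk₀⟩ := eventually_atTop.1 ((hqm a ha).and hbound)
  have hϱ2 : (ENNReal.ofReal ϱ ^ 2) ≠ 0 := pow_ne_zero _ (ENNReal.ofReal_pos.2 hϱ).ne'
  have hϱ2' : (ENNReal.ofReal ϱ ^ 2) ≠ ∞ := ENNReal.pow_ne_top ENNReal.ofReal_ne_top
  -- unscaled bounds `∫_{Q_ϱ(z)} |q_k|^{3/2} ≤ ϱ² K`
  have hPk : ∀ j, k₀ ≤ j → ∫⁻ y in parabolicCylinder ϱ z, ‖uncurry (q j) y‖ₑ ^ (3 / 2 : ℝ) ≤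
      ENNReal.ofReal ϱ ^ 2 * K := by
    intro j hj
    have h := (hk₀ j hj).2
    rw [cknD] at h
    calc ∫⁻ y in parabolicCylinder ϱ z, ‖uncurry (q j) y‖ₑ ^ (3 / 2 : ℝ)
        = ENNReal.ofReal ϱ ^ 2 * ((ENNReal.ofReal ϱ ^ 2)⁻¹ *
            ∫⁻ y in parabolicCylinder ϱ z, ‖q j y.1 y.2‖ₑ ^ (3 / 2 : ℝ)) := by
          rw [← mul_assoc, ENNReal.mul_inv_cancel hϱ2 hϱ2', one_mul]; rfl
      _ ≤ ENNReal.ofReal ϱ ^ 2 * K := by gcongr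
  have key := setLIntegral_rpow_threeHalves_le_of_tendsto_weakly
    (measurableSet_Ioo.prod measurableSet_ball) hQ (P := fun j => uncurry (q j)) (π := uncurry π)
    (hπ a ha) (j₀ := k₀) (fun j hj => (hk₀ j hj).1) hPk
    (fun g hg => by simpa [uncurry] using hweak a ha g hg)
  rw [cknD]
  calc (ENNReal.ofReal ϱ ^ 2)⁻¹ * ∫⁻ y in parabolicCylinder ϱ z, ‖π y.1 y.2‖ₑ ^ (3 / 2 : ℝ)
      ≤ (ENNReal.ofReal ϱ ^ 2)⁻¹ * (ENNReal.ofReal ϱ ^ 2 * K) := by gcongr; exact key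
    _ = K := by rw [← mul_assoc, ENNReal.inv_mul_cancel hϱ2 hϱ2', one_mul]

/-! ### Uniformly local dissipation of the limit -/

/-- **Uniformly local dissipation from apex-wise scale-invariant bounds** (the hypothesis `hG` of
`Seregin2019.exists_restart_weakL3`; in print `E(w, ϱ; z₀) ≤ Θ ≤ c(M,N)`). Let `(w, π)` be a
suitable weak solution in every `Q(a)` with `C(ϱ; z)[w] ≤ K` and `D(ϱ; z)[π] ≤ K` for every apex
`z` with `z.1 ≤ 0` and every `ϱ > 0`. Then `w` has a weak spatial gradient on `]-∞,0[ × ℝ³` whose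
dissipation on the boxes `]-T,0[ × B(x₀,R)` is bounded independently of `x₀`. Proof: verbatim the
tree's `ESSBlowup.exists_weakGradient_uniform_dissipation` (Lemarié-Rieusset's absolute local
energy bound `localEnergyBound` on the cylinders `Q_ρ(t₁,x₀)`, `t₁ ↑ 0`, then monotone
convergence), with the global bound of the `L³` case replaced by `K`.
[cite: Seregin2019, §4 p. 8 (Θ(w,r,ϱ;z₀) ≤ c(M,N) for the ancient solution)] [cite: LemarieRieusset2016, proof of Thm. 14.4 (absolute local energy bound)] -/
theorem exists_weakGradient_uniform_dissipation_of_bounds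
    (hw : ∀ a : ℝ, 0 < a → IsSuitableWeakSolutionInBall a (0 : ℝ × EuclideanSpace ℝ (Fin 3)) w π)
    {K : ℝ≥0}
    (hC : ∀ z : ℝ × EuclideanSpace ℝ (Fin 3), z.1 ≤ 0 → ∀ ϱ : ℝ, 0 < ϱ → cknC ϱ z w ≤ K)
    (hD : ∀ z : ℝ × EuclideanSpace ℝ (Fin 3), z.1 ≤ 0 → ∀ ϱ : ℝ, 0 < ϱ → cknD ϱ z π ≤ K) :
    ∃ G : ℝ → EuclideanSpace ℝ (Fin 3) → EuclideanSpace ℝ (Fin 3) →L[ℝ] EuclideanSpace ℝ (Fin 3),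
      HasWeakSpatialGradientOn (slab (EuclideanSpace ℝ (Fin 3)) (Iio 0) isOpen_Iio) w G ∧
      ∀ T : ℝ, 0 < T → ∀ R : ℝ, 0 < R → ∃ C : ℝ≥0∞, C ≠ ∞ ∧ ∀ x₀ : EuclideanSpace ℝ (Fin 3),
        ∫⁻ z in Ioo (-T) 0 ×ˢ ball x₀ R, ENNReal.ofReal (frobeniusNormSq (G z.1 z.2)) ≤ C := by
  have hslab := ESSBlowup.isSuitableWeakSolutionOn_halfspace hw
  obtain ⟨G, hG, -, -⟩ := hslab.localEnergy
  refine ⟨G, hG, fun T hT R hR => ?_⟩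
  obtain ⟨c₁, c₂, c₃, c₄, H⟩ := localEnergyBound one_pos
  -- the radius `ρ = 2 (R + √T + 1)`: `ρ/2 ≥ R`, `(ρ/2)² ≥ T + 1`
  set ρ : ℝ := 2 * (R + Real.sqrt T + 1) with hρ
  have hρpos : 0 < ρ := by rw [hρ]; positivity
  have hρR : R ≤ 1 / 2 * ρ := by rw [hρ]; linarith [Real.sqrt_nonneg T]
  have hρT : T + 1 ≤ (1 / 2 * ρ) ^ 2 := by
    have h1 : Real.sqrt T ^ 2 = T := Real.sq_sqrt hT.le
    have h2 : 1 / 2 * ρ = R + Real.sqrt T + 1 := by rw [hρ]; ring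
    rw [h2]
    nlinarith [Real.sqrt_nonneg T, hR.le]
  set Cb : ℝ≥0∞ := (K : ℝ≥0∞) with hCb
  have hCbfin : Cb ≠ ⊤ := ENNReal.coe_ne_top
  -- the uniform bound
  set B : ℝ≥0∞ := ENNReal.ofReal (1 / 2 * ρ) *
    (c₁ * ENNReal.ofReal ((1 / 2 : ℝ) ^ 2) * Cb ^ (2 / 3 : ℝ) +
      c₂ * ENNReal.ofReal (((1 / 2 : ℝ) ^ 2)⁻¹) * Cb +
      c₃ * ENNReal.ofReal (((1 / 2 : ℝ) ^ 2)⁻¹) * Cb ^ (2 / 3 : ℝ) * Cb ^ (1 / 3 : ℝ)) with hB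
  have hBfin : B ≠ ⊤ := by
    refine ENNReal.mul_ne_top ENNReal.ofReal_ne_top (ENNReal.add_ne_top.2 ⟨ENNReal.add_ne_top.2 ⟨?_, ?_⟩, ?_⟩)
    · exact ENNReal.mul_ne_top (ENNReal.mul_ne_top ENNReal.coe_ne_top ENNReal.ofReal_ne_top)
        (ENNReal.rpow_ne_top_of_nonneg (by norm_num) hCbfin)
    · exact ENNReal.mul_ne_top (ENNReal.mul_ne_top ENNReal.coe_ne_top ENNReal.ofReal_ne_top) hCbfin
    · exact ENNReal.mul_ne_top (ENNReal.mul_ne_top (ENNReal.mul_ne_top ENNReal.coe_ne_top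
        ENNReal.ofReal_ne_top) (ENNReal.rpow_ne_top_of_nonneg (by norm_num) hCbfin))
        (ENNReal.rpow_ne_top_of_nonneg (by norm_num) hCbfin)
  refine ⟨B, hBfin, fun x₀ => ?_⟩
  -- ## the bound on the cylinders hanging from `t₁ ∈ [-1, 0)`
  have hcyl : ∀ t₁ : ℝ, t₁ < 0 → -1 ≤ t₁ →
      ∫⁻ z in parabolicCylinder (1 / 2 * ρ) ((t₁, x₀) : ℝ × EuclideanSpace ℝ (Fin 3)),
        ENNReal.ofReal (frobeniusNormSq (G z.1 z.2)) ≤ B := by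
    intro t₁ ht₁ ht₁'
    set z₁ : ℝ × EuclideanSpace ℝ (Fin 3) := (t₁, x₀) with hz₁
    have hcl := ESSBlowup.closure_parabolicCylinder_subset_halfspace hρpos ht₁ x₀
    have hf0 : MemLp (uncurry (0 : ℝ → EuclideanSpace ℝ (Fin 3) → EuclideanSpace ℝ (Fin 3)))
        (ENNReal.ofReal (3 / 2))
        (volume.restrict (slab (EuclideanSpace ℝ (Fin 3)) (Iio 0) isOpen_Iio : Set _)) := by
      have e : uncurry (0 : ℝ → EuclideanSpace ℝ (Fin 3) → EuclideanSpace ℝ (Fin 3)) =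
          fun _ => 0 := rfl
      rw [e]
      exact MemLp.zero'
    have key := H _ (3 / 2) 0 w π G hslab (le_refl _) hf0 hG z₁ ρ (1 / 2) hρpos (by norm_num)
      (by norm_num) hcl
    -- `C(ρ) ≤ K`, `D(ρ) ≤ K`, `F = 0`
    have hC' : cknC ρ z₁ w ≤ Cb := hC z₁ ht₁.le ρ hρpos
    have hDle : cknD ρ z₁ π ≤ Cb := hD z₁ ht₁.le ρ hρpos
    have hF : cknF (3 / 2) ρ z₁ (0 : ℝ → EuclideanSpace ℝ (Fin 3) → EuclideanSpace ℝ (Fin 3)) = 0 := by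
      rw [cknF]
      simp
    have hF' : cknF (3 / 2) ρ z₁ (0 : ℝ → EuclideanSpace ℝ (Fin 3) → EuclideanSpace ℝ (Fin 3)) ^
        (1 / (3 / 2 : ℝ)) = 0 := by
      rw [hF]
      exact ENNReal.zero_rpow_of_pos (by norm_num)
    rw [hF', mul_zero, zero_mul, add_zero] at key
    have hE : cknE (1 / 2 * ρ) z₁ G ≤
        c₁ * ENNReal.ofReal ((1 / 2 : ℝ) ^ 2) * Cb ^ (2 / 3 : ℝ) +
          c₂ * ENNReal.ofReal (((1 / 2 : ℝ) ^ 2)⁻¹) * Cb +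
          c₃ * ENNReal.ofReal (((1 / 2 : ℝ) ^ 2)⁻¹) * Cb ^ (2 / 3 : ℝ) * Cb ^ (1 / 3 : ℝ) := by
      refine le_add_self.trans (key.trans ?_)
      have h23 : cknC ρ z₁ w ^ (2 / 3 : ℝ) ≤ Cb ^ (2 / 3 : ℝ) := ENNReal.rpow_le_rpow hC' (by norm_num)
      have h13 : cknC ρ z₁ w ^ (1 / 3 : ℝ) ≤ Cb ^ (1 / 3 : ℝ) := ENNReal.rpow_le_rpow hC' (by norm_num)
      have hD23 : cknD ρ z₁ π ^ (2 / 3 : ℝ) ≤ Cb ^ (2 / 3 : ℝ) := ENNReal.rpow_le_rpow hDle (by norm_num)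
      gcongr
    -- unscale: `∫_{Q} |G|² = (ρ/2) E(ρ/2)`
    have hρ2 : 0 < 1 / 2 * ρ := by positivity
    have hinv : ENNReal.ofReal (1 / 2 * ρ) * (ENNReal.ofReal (1 / 2 * ρ))⁻¹ = 1 :=
      ENNReal.mul_inv_cancel (ENNReal.ofReal_pos.2 hρ2).ne' ENNReal.ofReal_ne_top
    calc ∫⁻ z in parabolicCylinder (1 / 2 * ρ) z₁, ENNReal.ofReal (frobeniusNormSq (G z.1 z.2))
        = ENNReal.ofReal (1 / 2 * ρ) * cknE (1 / 2 * ρ) z₁ G := by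
          rw [cknE]
          symm
          calc ENNReal.ofReal (1 / 2 * ρ) * ((ENNReal.ofReal (1 / 2 * ρ))⁻¹ *
                ∫⁻ q in parabolicCylinder (1 / 2 * ρ) z₁, ENNReal.ofReal (frobeniusNormSq (G q.1 q.2)))
              = ENNReal.ofReal (1 / 2 * ρ) * (ENNReal.ofReal (1 / 2 * ρ))⁻¹ *
                ∫⁻ q in parabolicCylinder (1 / 2 * ρ) z₁, ENNReal.ofReal (frobeniusNormSq (G q.1 q.2)) :=
                (mul_assoc _ _ _).symm
            _ = _ := by rw [hinv, one_mul]
      _ ≤ B := by rw [hB]; gcongr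
  -- ## the boxes `]-T, t₁[ × B(x₀, R)` with `t₁ = -1/(k+1) ↑ 0`
  set t : ℕ → ℝ := fun k => -(1 / ((k : ℝ) + 1)) with ht
  have htneg : ∀ k, t k < 0 := fun k => by simp only [ht]; exact neg_neg_of_pos (by positivity)
  have htge : ∀ k, -1 ≤ t k := fun k => by
    simp only [ht, neg_le_neg_iff]
    rw [div_le_one (by positivity)]
    linarith [k.cast_nonneg (α := ℝ)]
  have hbox : ∀ k, Ioo (-T) (t k) ×ˢ ball x₀ R ⊆
      parabolicCylinder (1 / 2 * ρ) ((t k, x₀) : ℝ × EuclideanSpace ℝ (Fin 3)) := by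
    intro k z hz
    rw [mem_parabolicCylinder]
    obtain ⟨⟨hz1, hz2⟩, hz3⟩ := mem_prod.1 hz
    refine ⟨⟨?_, hz2⟩, lt_of_lt_of_le hz3 hρR⟩
    show t k - (1 / 2 * ρ) ^ 2 < z.1
    linarith [htneg k, hρT, hz1, htge k]
  have hk : ∀ k, ∫⁻ z in Ioo (-T) (t k) ×ˢ ball x₀ R, ENNReal.ofReal (frobeniusNormSq (G z.1 z.2)) ≤ B :=
    fun k => (lintegral_mono_set (hbox k)).trans (hcyl (t k) (htneg k) (htge k))
  -- monotone convergence in `k`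
  have hmono : Monotone fun k => Ioo (-T) (t k) ×ˢ ball x₀ R := by
    intro k l hkl
    refine prod_mono (Ioo_subset_Ioo le_rfl ?_) Subset.rfl
    simp only [ht, neg_le_neg_iff]
    exact one_div_le_one_div_of_le (by positivity) (by simpa using hkl)
  have hU : (⋃ k, Ioo (-T) (t k) ×ˢ ball x₀ R) = Ioo (-T) 0 ×ˢ ball x₀ R := by
    rw [← iUnion_prod_const]
    congr 1
    ext s
    simp only [mem_iUnion, mem_Ioo]
    constructor
    · rintro ⟨k, h1, h2⟩; exact ⟨h1, h2.trans (htneg k)⟩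
    · rintro ⟨h1, h2⟩
      obtain ⟨k, hk'⟩ := exists_nat_one_div_lt (neg_pos.2 h2)
      exact ⟨k, h1, by simp only [ht]; linarith⟩
  rw [← hU, setLIntegral_iUnion_of_directed _ hmono.directed_le]
  exact iSup_le hk

end Seregin2019

end Literature.Analysis.FluidPDE

end
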